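import Summits.BirchSwinnertonDyer.Rank1Residual.X2.GreenbergVatsalStrictCore
import Summits.BirchSwinnertonDyer.Rank1Residual.X2.GreenbergVatsalSelmerEqualityCited
import Summits.BirchSwinnertonDyer.Rank1Residual.X2.GreenbergVatsalReductionDatumLine
import Literature.NumberTheory.EllipticCurves.CyclotomicTowerLocalFrobeniusProofs
import Literature.NumberTheory.EllipticCurves.LocalFrobeniusGenerationProofs
import Literature.NumberTheory.EllipticCurves.GaloisActionProofs
import HarnessLib

/-!
# Greenberg's local condition at `p` over `ℚ_∞^{cyc}`, I: the unramified quotient `D = E[p^∞]/C_p` —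
# `Frob − 1` is surjective on `D` ("`H¹(G_𝔭/I_𝔭, Ẽ[p^∞]) = 0`"), inertia fills the layers

HONEST FRAMING (cell `b2b-bsdres`, run/shared/lean/b2b/bsd-rank1-residual/, verbatim in every
file): the goal of the cell is to DELETE the COMBINATION-SHAPED residual classes of the
Birch–Swinnerton-Dyer formula for ALL analytic-rank `≤ 1` elliptic curves over `ℚ` — "full BSD
formula for every rank `≤ 1` curve in class `C`" assembled STRICTLY from published theorems — so
that the rank-`≤ 1` remainder becomes exactly the CONSTRUCTION-SHAPED classes, which are TYPED
(missing-input `Prop`s), NOT attempted. This is not "finishing BSD". Sub-cell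
`b2b-bsdres-eisenstein-p2` (CLASS-OWNERS row "X2"), gen 10: research route; NO CLAIM BEYOND STATED
CLASSES; nothing here changes a label. THEOREMS ONLY (no `def`, no named fact, nothing asserted).

WHY. The cell's identification `Sel_{p^∞}(E/ℚ_∞) = S^{Σ₀}_{E[p^∞]}(ℚ_∞) ⊓ (Kummer at Σ₀)`
(`GreenbergVatsalSelmerEqualityCited`) rests on ONE printed local statement at the prime above `p`:
`L_𝔭 ⊆ im κ_𝔭` (Literature fact `GreenbergVatsal2000.imKummer_ge_greenbergCondition_at_p`, GV 2000
p. 26 "In [Gre99], one can find a proof that `im(κ_𝔭) = L_𝔭`"). GV's `L_𝔭` is the INERTIA-form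
condition `ker(H¹((ℚ_∞)_𝔭, A) → H¹(I_𝔭, D))` (p. 16; the tree's `LocalDatum.greenbergKer`), whereas
what Greenberg proves (LNM 1716 Props. 2.2, 2.4, pp. 73–75) is about the DECOMPOSITION-form
condition `Im λ_K = ker(H¹(K, E[p^∞]) → H¹(K, Ẽ[p^∞]))`, `K = (ℚ_∞)_𝔭` (the tree's
`LocalDatum.strictKer`, Greenberg 1989's "strict" condition). This file and its sibling
`GreenbergVatsalStrictAtP` PROVE in the kernel that the two conditions COINCIDE for Greenberg's
datum `C_p = ker(E[p^∞] → Ẽ)` of a good ordinary `p` over `ℚ_∞^{cyc}`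
(`GreenbergVatsalStrictAtP.greenbergKer_eq_strictKer`), so that the cited input is exactly Greenberg's
printed propositions (plus the injectivity of `H¹(K, Ẽ[p^∞]) → H¹(K, Ẽ(𝔽̄_p))`, loc. cit. p. 74).
The mathematics is Greenberg's remark (p. 73) "`E[p^∞]/C_v` is the maximal unramified quotient of
`E[p^∞]`" together with `H¹(G_𝔭/I_𝔭, D) = D/(Frob − 1)D = 0`:

* §1 `D_v` is profinite (closed in `Γ_ℚ`); LOCAL Frobenius generation pushed into `D_v`
  (`exists_eq_frob_pow_mul_of_decomp` ← `LocalFrobeniusGenerationProofs`, `inertia_eq_absInertia`).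
* §2 the cyclotomic tower at `v ∋ p`: `κ(I_v) = Gal(ℚ_∞/ℚ)` (`exists_mem_inertia_kappa_eq` ←
  `χ_p(I_{𝔓₀}) = ℤ_pˣ`, tree `exists_mem_inertia_cyclotomicCharacter_eq`), hence inertia fills
  every layer (`exists_layer_le_kappa_inertia`: deep values of `κ` are values on `U ∩ I_v` for any
  open normal `U ≤ D_v`, by `[I_v : I_v ∩ U]`-th powers).
* §3 the unramified quotient `D = E[p^∞]/C_p` as a `D_v`-module: continuous orbits, `I_v` acts
  trivially (gen 9 `reductionDatum_htriv`), the Frobenius-fixed points are FINITE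
  (`finite_fixed_frob` ← `exists_finset_localRed_smul_frobenius`: "`Ẽ(𝔽_p)` is finite"), `D[p^k]`
  is finite (`finite_torsionBy_gr` ← `localRed_ordinary_filtration`: `red` maps `E[p^k]` onto
  `Ẽ[p^k]`, Silverman III.6.4), `D` is `p`-divisible and `p`-primary; hence **`Frob − 1` is
  SURJECTIVE on `D`** (`exists_frob_smul_sub_eq` ← `GreenbergVatsalStrictCore.surjective_of_finite_ker_of_divisible`).
* (sibling file, §4) `greenbergKer_le_strictKer` / `greenbergKer_eq_strictKer`: with the local Frobenius
  `τ ∈ Γ_{ℚ_v}` fixing `μ_{p^∞}` (so `res τ ∈ Gal(ℚ̄/ℚ_∞)`: `ℚ_∞/ℚ` is totally ramified at `p`, tree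
  `ZpExtension.IsCyclotomic.exists_isArithFrobAt_resGal_mem_kerSubgroup`), the abstract theorem
  `GreenbergVatsalStrictCore.exists_eq_smul_sub_of_vanishing_on_inertia_of_surjective` applied to
  `G = D_v`, `I = I_v`, `P = Gal(ℚ̄/ℚ_∞) ∩ D_v`, `D = E[p^∞]/C_p`.

References: Greenberg, LNM 1716 (1999) §2 pp. 73–75 (C_v, Props. 2.2, 2.4), §3 p. 89;
Greenberg, Adv. Stud. Pure Math. 17 (1989) p. 98 ((4), "strict"); Greenberg–Vatsal (2000) §2
pp. 16, 26; Serre, *Local Fields* XIII §1; Washington, *Cyclotomic Fields* §13.1.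
-/

noncomputable section

open scoped Classical NNReal

universe u

namespace Summit.BirchSwinnertonDyer.Rank1Residual.X2.GreenbergVatsalStrictAtPQuotient

open NumberField IsDedekindDomain Field Literature.NumberTheory.GaloisRepresentations
  Literature.NumberTheory.EllipticCurves Literature.NumberTheory.EllipticCurves.GreenbergSelmer
  Literature.NumberTheory.EllipticCurves.ResKernel
  Summit.BirchSwinnertonDyer.Rank1Residual.X2.GreenbergVatsalTorsion
  Summit.BirchSwinnertonDyer.Rank1Residual.X2.GreenbergVatsalReductionDatum
  Summit.BirchSwinnertonDyer.Rank1Residual.X2.GreenbergVatsalStrictCore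

/-! ## §1. The decomposition group `D_v` as a profinite group; local Frobenius generation inside it -/

section Decomp

variable {K : Type u} [Field K] [NumberField K] (v : HeightOneSpectrum (𝓞 K))

/-- `D_v` is closed in `Γ_K`. [folklore] -/
theorem isClosed_decomp :
    IsClosed ((decomp (K := K) v : Subgroup (absoluteGaloisGroup K)) : Set (absoluteGaloisGroup K)) := by
  have hDeq : decomp v = (adicCompletionPrime K v).decompositionSubgroup (absoluteGaloisGroup K) :=
    (decompositionSubgroup_adicCompletionPrime_eq_range K v).symm
  rw [hDeq]
  exact absIntegers.isClosed_decompositionSubgroup_holds (R := 𝓞 K) (adicCompletionPrime K v)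

/-- `D_v` is compact. [folklore] -/
theorem compactSpace_decomp : CompactSpace (decomp (K := K) v) :=
  isCompact_iff_compactSpace.mp (isClosed_decomp v).isCompact

/-- The local restriction map `Γ_{K_v} → D_v` (range-restricted) is continuous. [folklore] -/
theorem continuous_toDecomp :
    Continuous fun σ : absoluteGaloisGroup (v.adicCompletion K) ↦
      (⟨absGaloisRestrict K (v.adicCompletion K) σ, ⟨σ, rfl⟩⟩ : decomp (K := K) v) :=
  (absGaloisRestrict K (v.adicCompletion K)).continuous.subtype_mk _

/-- **Local Frobenius generation inside `D_v`**: for an arithmetic Frobenius `τ ∈ Γ_{K_v}` at a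
prime `𝔐` of `\bar 𝓞_v` (spectral valuation `w`), every element of `D_v` is
`(res τ)ⁿ · i · u` with `i ∈ I_v` and `u` in any prescribed open subgroup of `D_v`
(`exists_eq_frobenius_pow_mul_inertia_mul` pushed along `res : Γ_{K_v} ↠ D_v`, with
`I_𝔐 = I_{K_v}`, `inertia_eq_absInertia`). [cite: NeukirchANT1999, Ch. II §9 Prop. (9.9)–(9.11)] -/
theorem exists_eq_frob_pow_mul_of_decomp
    {w : Valuation (AlgebraicClosure (v.adicCompletion K)) ℝ≥0}
    (hw : ∀ x, (w x : ℝ) =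
      spectralNorm (v.adicCompletion K) (AlgebraicClosure (v.adicCompletion K)) x)
    {𝔐 : Ideal v.localAbsIntegers} (h𝔐 : 𝔐 ∈ v.localPrimesAbove)
    {τ : absoluteGaloisGroup (v.adicCompletion K)}
    (hτ : IsArithFrobAt (v.adicCompletionIntegers K) τ 𝔐)
    (U : Subgroup (decomp (K := K) v)) (hU : IsOpen (U : Set (decomp (K := K) v)))
    (d : decomp (K := K) v) :
    ∃ (n : ℕ) (i u : decomp (K := K) v), (i : absoluteGaloisGroup K) ∈ inertia v ∧ u ∈ U ∧
      d = ⟨absGaloisRestrict K (v.adicCompletion K) τ, ⟨τ, rfl⟩⟩ ^ n * i * u := by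
  let r : absoluteGaloisGroup (v.adicCompletion K) →* decomp (K := K) v :=
    { toFun := fun σ ↦ ⟨absGaloisRestrict K (v.adicCompletion K) σ, ⟨σ, rfl⟩⟩
      map_one' := Subtype.ext (map_one _)
      map_mul' := fun a b ↦ Subtype.ext (map_mul _ a b) }
  have hr : ∀ σ, ((r σ : decomp (K := K) v) : absoluteGaloisGroup K) =
      absGaloisRestrict K (v.adicCompletion K) σ := fun _ ↦ rfl
  have hUo : IsOpen ((U.comap r : Subgroup (absoluteGaloisGroup (v.adicCompletion K))) :
      Set (absoluteGaloisGroup (v.adicCompletion K))) :=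
    hU.preimage (continuous_toDecomp v)
  obtain ⟨σ, hσ⟩ := (mem_decomp_iff v (d : absoluteGaloisGroup K)).1 d.2
  obtain ⟨n, ι, u, hι, hu, hdec⟩ := v.exists_eq_frobenius_pow_mul_inertia_mul h𝔐 hτ hUo σ
  refine ⟨n, r ι, r u, ?_, hu, ?_⟩
  · rw [IsDedekindDomain.HeightOneSpectrum.inertia_eq_absInertia hw h𝔐] at hι
    exact ⟨ι, hι, rfl⟩
  · apply Subtype.ext
    simp only [Subgroup.coe_mul, SubgroupClass.coe_pow, hr]
    rw [← hσ, hdec, map_mul, map_mul, map_pow]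

end Decomp

/-! ## §2. The cyclotomic tower over `ℚ` at `p`: inertia fills every layer -/

section Layers

variable {p : ℕ} [hp : Fact p.Prime] (κ : ZpExtension ℚ p) (v : HeightOneSpectrum (𝓞 ℚ))

/-- **`κ(I_v) = Gal(ℚ_∞/ℚ)` at `v ∋ p` for the cyclotomic tower**: every value of `κ` is taken on
the inertia group `I_v` (from `χ_p(I_{𝔓₀}) = ℤ_pˣ`, tree `exists_mem_inertia_cyclotomicCharacter_eq`,
and `ker κ = χ_p⁻¹(μ(ℤ_p))`). [cite: SerreLocalFields1979, Ch. IV §4 Prop. 17]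
[cite: Washington1997, §13.1] -/
theorem exists_mem_inertia_kappa_eq (hκ : κ.IsCyclotomic) (hpv : ((p : ℕ) : 𝓞 ℚ) ∈ v.asIdeal)
    (t : Multiplicative ℤ_[p]) :
    ∃ y ∈ inertia v, κ y = t := by
  obtain ⟨g, rfl⟩ := κ.surjective t
  have hv : (Rat.HeightOneSpectrum.primesEquiv v : ℕ) = p :=
    Rat.HeightOneSpectrum.primesEquiv_eq_of_natCast_mem v hp.out hpv
  obtain ⟨y, hy, hχ⟩ := Literature.NumberTheory.EllipticCurves.exists_mem_inertia_cyclotomicCharacter_eq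
    p hv (adicCompletionPrime_mem_primesAbove ℚ v) (GaloisRep.cyclotomicCharacter ℚ p g)
  have hIeq : inertia v = (adicCompletionPrime ℚ v).inertia (absoluteGaloisGroup ℚ) :=
    (inertia_adicCompletionPrime_eq_map_absInertia ℚ v).symm
  refine ⟨y, by rw [hIeq]; exact hy, ?_⟩
  have hmem : y⁻¹ * g ∈ κ.kerSubgroup := by
    rw [hκ, Subgroup.mem_comap]
    change GaloisRep.cyclotomicCharacter ℚ p (y⁻¹ * g) ∈ CommGroup.torsion ℤ_[p]ˣ
    rw [map_mul, map_inv, hχ, inv_mul_cancel]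
    exact (CommGroup.torsion ℤ_[p]ˣ).one_mem
  rw [ZpExtension.mem_kerSubgroup, map_mul, map_inv, inv_mul_eq_one] at hmem
  exact hmem

/-- **Inertia fills the layers**: for every open normal subgroup `U` of `D_v` there is `B` such that
every value of `κ` divisible by `p^B` is `κ(w)` for some `w ∈ U ∩ I_v` (the `[I_v : I_v ∩ U]`-th
powers of `I_v` lie in `U`, and `κ(I_v) = ℤ_p`). [folklore] -/
theorem exists_layer_le_kappa_inertia (hκ : κ.IsCyclotomic) (hpv : ((p : ℕ) : 𝓞 ℚ) ∈ v.asIdeal)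
    (U : Subgroup (decomp (K := ℚ) v)) [U.Normal] (hU : IsOpen (U : Set (decomp (K := ℚ) v))) :
    ∃ B : ℕ, ∀ u : decomp (K := ℚ) v,
      (p : ℤ_[p]) ^ B ∣ (κ (u : absoluteGaloisGroup ℚ)).toAdd →
        ∃ w ∈ U, (w : absoluteGaloisGroup ℚ) ∈ inertia v ∧
          κ (w : absoluteGaloisGroup ℚ) = κ (u : absoluteGaloisGroup ℚ) := by
  -- `I₀ = I_v` inside `D_v`; `U ∩ I₀` has finite index `n` in `I₀`
  set I₀ : Subgroup (decomp (K := ℚ) v) := (inertia v).subgroupOf (decomp v) with hI₀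
  haveI := compactSpace_decomp (K := ℚ) v
  haveI : Finite (decomp (K := ℚ) v ⧸ U) := Subgroup.quotient_finite_of_isOpen _ hU
  haveI hUfi : U.FiniteIndex := Subgroup.finiteIndex_of_finite_quotient
  haveI : (U.subgroupOf I₀).FiniteIndex := inferInstance
  haveI : (U.subgroupOf I₀).Normal := inferInstance
  set n := (U.subgroupOf I₀).index with hn
  have hn0 : n ≠ 0 := Subgroup.FiniteIndex.index_ne_zero
  obtain ⟨B, m, hm, hnm⟩ := Nat.exists_eq_pow_mul_and_not_dvd hn0 p hp.out.ne_one
  obtain ⟨mu, hmu⟩ := IwasawaDual.isUnit_natCast_padicInt (p := p) hm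
  refine ⟨B, fun u hu ↦ ?_⟩
  obtain ⟨c, hc⟩ := hu
  -- `κ u = n • s` with `s = m⁻¹ c`
  set s : ℤ_[p] := ((mu⁻¹ : ℤ_[p]ˣ) : ℤ_[p]) * c with hs
  have hns : (n : ℤ_[p]) * s = (κ (u : absoluteGaloisGroup ℚ)).toAdd := by
    rw [hc, hnm, Nat.cast_mul, Nat.cast_pow, ← hmu, hs]
    rw [mul_assoc, ← mul_assoc (mu : ℤ_[p]), Units.mul_inv, one_mul]
  -- `y ∈ I_v` with `κ y = s`, and `w = y^n`
  obtain ⟨y, hyI, hκy⟩ := exists_mem_inertia_kappa_eq κ v hκ hpv (Multiplicative.ofAdd s)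
  have hyD : y ∈ decomp v := inertia_le_decomp v hyI
  set y₀ : I₀ := ⟨⟨y, hyD⟩, (Subgroup.mem_subgroupOf).2 hyI⟩ with hy₀
  have hw : (y₀ ^ n : I₀) ∈ U.subgroupOf I₀ := Subgroup.pow_index_mem _ y₀
  refine ⟨⟨y, hyD⟩ ^ n, ?_, ?_, ?_⟩
  · have := (Subgroup.mem_subgroupOf).1 hw
    simpa only [SubgroupClass.coe_pow] using this
  · rw [SubgroupClass.coe_pow]
    exact (inertia v).pow_mem hyI n
  · apply Multiplicative.toAdd.injective
    rw [SubgroupClass.coe_pow, map_pow, toAdd_pow, hκy, toAdd_ofAdd, nsmul_eq_mul, hns]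

/-- The layers `κ⁻¹(p^B ℤ_p) ∩ D_v` are open in `D_v`. [folklore] -/
theorem exists_open_layer (B : ℕ) :
    ∃ V : Subgroup (decomp (K := ℚ) v), IsOpen (V : Set (decomp (K := ℚ) v)) ∧
      ∀ x ∈ V, (p : ℤ_[p]) ^ B ∣ (κ (x : absoluteGaloisGroup ℚ)).toAdd :=
  ⟨(κ.layerSubgroup B).subgroupOf (decomp v), (κ.isOpen_layerSubgroup B).preimage continuous_subtype_val,
    fun _ hx ↦ ZpExtension.mem_layerSubgroup.1 ((Subgroup.mem_subgroupOf).1 hx)⟩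

end Layers

/-! ## §3. The unramified quotient `D = E[p^∞]/C_p` of Greenberg's datum: `I_p` acts trivially,
continuity, finiteness of Frobenius-fixed points and of `p^k`-torsion, divisibility,
and SURJECTIVITY of `Frob − 1` -/

section Quotient

variable (W : WeierstrassCurve ℚ) [W.IsGloballyMinimal] [W.IsElliptic] (p : ℕ) [hp : Fact p.Prime]
  {v : HeightOneSpectrum (𝓞 ℚ)} (hpv : ((p : ℕ) : 𝓞 ℚ) ∈ v.asIdeal)
  (hΔ : ¬ (p : ℤ) ∣ W.minimalDiscriminantInt)

omit [W.IsElliptic] in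
/-- Continuity of the orbit maps of `D_v` on `D = E[p^∞]/C_v` (discrete). [folklore] -/
theorem continuous_smul_gr (d : (reductionDatum W p hpv hΔ).Gr) :
    Continuous fun g : decomp (K := ℚ) v ↦ g • d := by
  obtain ⟨m, rfl⟩ := (reductionDatum W p hpv hΔ).grMk_surjective d
  have e : (fun g : decomp (K := ℚ) v ↦ g • (reductionDatum W p hpv hΔ).grMk m) =
      fun g : decomp (K := ℚ) v ↦
        (reductionDatum W p hpv hΔ).grMk (((g : decomp (K := ℚ) v) : absoluteGaloisGroup ℚ) • m) :=
    funext fun g ↦ LocalDatum.smul_grMk _ g m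
  rw [e]
  exact continuous_of_discreteTopology.comp
    ((W.continuous_smul_geomPrimaryTorsion p m).comp continuous_subtype_val)

/-- Equality of classes in `M ⧸ M⁺_v`: `grMk a = grMk b ↔ a - b ∈ M⁺_v`. [folklore] -/
theorem grMk_eq_grMk_iff {K : Type u} [Field K] [NumberField K] {M : Type u} [AddCommGroup M]
    [DistribMulAction (absoluteGaloisGroup K) M] {v : HeightOneSpectrum (𝓞 K)}
    (N : LocalDatum K M v) (a b : M) : N.grMk a = N.grMk b ↔ a - b ∈ N.plus := by
  rw [← sub_eq_zero, ← map_sub, ← AddMonoidHom.mem_ker, LocalDatum.ker_grMk]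

omit [W.IsElliptic] in
/-- **`I_v` acts trivially on `D = E[p^∞]/C_v`** (GV's "`I_p` acts trivially on `D`", gen 9's
`reductionDatum_htriv`). [cite: GreenbergVatsal2000, §2 p. 26] -/
theorem smul_gr_eq_of_mem_inertia {i : decomp (K := ℚ) v} (hi : (i : absoluteGaloisGroup ℚ) ∈ inertia v)
    (d : (reductionDatum W p hpv hΔ).Gr) : i • d = d := by
  obtain ⟨m, rfl⟩ := (reductionDatum W p hpv hΔ).grMk_surjective d
  rw [LocalDatum.smul_grMk, grMk_eq_grMk_iff]
  exact reductionDatum_htriv W p hpv hΔ _ hi m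

omit [W.IsElliptic] in
/-- Two elements of `E[p^∞]` with the same reduction have the same class in `D = E[p^∞]/C_v`.
[folklore] -/
theorem grMk_eq_grMk_of_localRed_eq {m m' : W.geomPrimaryTorsion p}
    (h : localRed W p hpv hΔ (pointsMap W (v.adicCompletion ℚ) (m : W.geomPoints)) =
      localRed W p hpv hΔ (pointsMap W (v.adicCompletion ℚ) (m' : W.geomPoints))) :
    (reductionDatum W p hpv hΔ).grMk m = (reductionDatum W p hpv hΔ).grMk m' := by
  rw [grMk_eq_grMk_iff, mem_reductionDatum_plus_iff, AddSubgroupClass.coe_sub, map_sub, map_sub, h,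
    sub_self]

omit [W.IsElliptic] in
/-- The class of `m` in `D` is fixed by `δ ∈ D_v` iff `red_v` of `δ • m` and of `m` agree. [folklore] -/
theorem smul_grMk_eq_iff (δ : decomp (K := ℚ) v) (m : W.geomPrimaryTorsion p) :
    δ • (reductionDatum W p hpv hΔ).grMk m = (reductionDatum W p hpv hΔ).grMk m ↔
      localRed W p hpv hΔ (pointsMap W (v.adicCompletion ℚ)
          (((δ : absoluteGaloisGroup ℚ) • m : W.geomPrimaryTorsion p) : W.geomPoints)) =
        localRed W p hpv hΔ (pointsMap W (v.adicCompletion ℚ) (m : W.geomPoints)) := by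
  rw [LocalDatum.smul_grMk]
  constructor
  · intro h
    rw [grMk_eq_grMk_iff, mem_reductionDatum_plus_iff, AddSubgroupClass.coe_sub, map_sub, map_sub,
      sub_eq_zero] at h
    exact h
  · exact grMk_eq_grMk_of_localRed_eq W p hpv hΔ

omit [W.IsElliptic] in
/-- **The points of `D = E[p^∞]/C_v` fixed by a Frobenius form a finite set** ("`Ẽ(𝔽_p)[p^∞]` is
finite"): for `τ ∈ Γ_{ℚ_v}` an arithmetic Frobenius at a prime `𝔐` of `\bar 𝓞_v` (spectral valuation
`specVal v`), `{d : (res τ) • d = d}` is finite — it injects into the finite set of reductions fixed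
by `τ` (`exists_finset_localRed_smul_frobenius`). [cite: GreenbergLNM1716, §2 p. 70] -/
theorem finite_fixed_frob {𝔐 : Ideal v.localAbsIntegers} (h𝔐 : 𝔐 ∈ v.localPrimesAbove)
    {τ : absoluteGaloisGroup (v.adicCompletion ℚ)}
    (hτ : IsArithFrobAt (v.adicCompletionIntegers ℚ) τ 𝔐) :
    Set.Finite {d : (reductionDatum W p hpv hΔ).Gr |
      (⟨absGaloisRestrict ℚ (v.adicCompletion ℚ) τ, ⟨τ, rfl⟩⟩ : decomp (K := ℚ) v) • d = d} := by
  set N := reductionDatum W p hpv hΔ with hN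
  obtain ⟨SF, hSF⟩ := W.exists_finset_localRed_smul_frobenius (specVal_spec v)
    (W.isUnit_Δ_localIntModel hpv (specVal_spec v) hΔ) (localRed W p hpv hΔ) (fun _ ↦ rfl) h𝔐 hτ
  -- choose representatives
  choose rep hrep using N.grMk_surjective
  let θ : N.Gr → _ := fun d ↦ localRed W p hpv hΔ (pointsMap W (v.adicCompletion ℚ) (rep d : W.geomPoints))
  have hθinj : Function.Injective θ := fun d d' h ↦ by
    rw [← hrep d, ← hrep d']
    exact grMk_eq_grMk_of_localRed_eq W p hpv hΔ h
  refine Set.Finite.subset (Set.Finite.preimage hθinj.injOn (SF.finite_toSet)) fun d hd ↦ ?_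
  rw [Set.mem_preimage, Finset.mem_coe]
  refine hSF _ ?_
  rw [Set.mem_setOf_eq, ← hrep d, smul_grMk_eq_iff, primaryComponent.coe_smul] at hd
  have e : (((⟨absGaloisRestrict ℚ (v.adicCompletion ℚ) τ, ⟨τ, rfl⟩⟩ : decomp (K := ℚ) v) :
      absoluteGaloisGroup ℚ)) = absGaloisRestrict ℚ (v.adicCompletion ℚ) τ := rfl
  rw [e, pointsMap_absGaloisRestrict_smul] at hd
  exact hd

/-- **`D[p^k]` is finite** ("`Ẽ[p^k]` is finite"): the `p^k`-torsion of `D = E[p^∞]/C_v` injects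
(via `red_v`) into `red_v(E(ℚ̄_v)[p^k])` (`localRed_ordinary_filtration`: `red_v` maps `E[p^k]` onto
`Ẽ[p^k]`; good ORDINARY `p`), a finite set (Silverman III.6.4). [cite: GreenbergLNM1716, §1 p. 62]
[cite: SilvermanAEC2009, Cor. III.6.4] -/
theorem finite_torsionBy_gr (hord : ¬ (p : ℤ) ∣ W.frobeniusTrace p) (k : ℕ) :
    Set.Finite {d : (reductionDatum W p hpv hΔ).Gr | p ^ k • d = 0} := by
  set N := reductionDatum W p hpv hΔ with hN
  -- residue characteristic `p` (as in `GreenbergVatsalReductionDatumLine`)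
  have hΔu := W.isUnit_Δ_localIntModel hpv (specVal_spec v) hΔ
  have hvO : (specVal v).Integers (specVal v).valuationSubring :=
    Valuation.valuationSubring.integers (specVal v)
  have hpO : specVal v ((p : ℕ) : AlgebraicClosure (v.adicCompletion ℚ)) < 1 := by
    have h := IsDedekindDomain.HeightOneSpectrum.spectralValuation_algebraMap_ringOfIntegers_lt_one (v := v)
      (specVal_spec v) hpv
    rwa [map_natCast] at h
  haveI hchar : CharP (IsLocalRing.ResidueField ↥(specVal v).valuationSubring) p := by
    refine (CharP.charP_iff_prime_eq_zero hp.out).mpr ?_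
    rw [← map_natCast (IsLocalRing.residue ↥(specVal v).valuationSubring),
      IsLocalRing.residue_eq_zero_iff, IsLocalRing.mem_maximalIdeal, mem_nonunits_iff,
      hvO.isUnit_iff_valuation_eq_one]
    exact fun h ↦ absurd h (ne_of_lt (by simpa using hpO))
  have hordA := W.exists_zsmul_eq_zero_localRed_ne_zero (specVal_spec v) hΔu (localRed W p hpv hΔ)
    (fun _ ↦ rfl) hpv hΔ hord
  obtain ⟨-, hsurjk, -⟩ := W.localRed_ordinary_filtration hΔu (localRed W p hpv hΔ) (fun _ ↦ rfl) hordA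
  -- the finite set of reductions of `p^k`-torsion points
  have hn : ((p ^ k : ℕ) : ℤ) ≠ 0 := by exact_mod_cast pow_ne_zero k hp.out.ne_zero
  haveI : Finite (WeierstrassCurve.torsionPoints W (AlgebraicClosure (v.adicCompletion ℚ)) ((p ^ k : ℕ) : ℤ)) :=
    W.finite_torsionPoints_holds (AlgebraicClosure (v.adicCompletion ℚ)) hn
  set T : Set (localPoints W (v.adicCompletion ℚ)) := {Q | ((p ^ k : ℕ) : ℤ) • Q = 0} with hT
  have hTfin : T.Finite := by
    haveI : Finite T := by
      refine Finite.of_injective (fun Q : T ↦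
        (⟨(Q : localPoints W (v.adicCompletion ℚ)), (W.mem_torsionPoints_iff _ _).2 Q.2⟩ :
          W.torsionPoints (AlgebraicClosure (v.adicCompletion ℚ)) ((p ^ k : ℕ) : ℤ))) ?_
      intro a b hab
      exact Subtype.ext (congrArg Subtype.val hab)
    exact Set.toFinite T
  choose rep hrep using N.grMk_surjective
  let θ : N.Gr → _ := fun d ↦ localRed W p hpv hΔ (pointsMap W (v.adicCompletion ℚ) (rep d : W.geomPoints))
  have hθinj : Function.Injective θ := fun d d' h ↦ by
    rw [← hrep d, ← hrep d']
    exact grMk_eq_grMk_of_localRed_eq W p hpv hΔ h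
  refine Set.Finite.subset (Set.Finite.preimage hθinj.injOn ((hTfin.image (localRed W p hpv hΔ))))
    fun d hd ↦ ?_
  rw [Set.mem_setOf_eq, ← hrep d, ← map_nsmul, ← AddMonoidHom.mem_ker,
    LocalDatum.ker_grMk, mem_reductionDatum_plus_iff, AddSubmonoidClass.coe_nsmul, map_nsmul,
    map_nsmul] at hd
  obtain ⟨x, hx, hxred⟩ := hsurjk k (θ d) (by rw [natCast_zsmul]; exact hd)
  exact ⟨x, hx, hxred⟩

/-- `D = E[p^∞]/C_v` is `p`-divisible and `p`-primary. [cite: SilvermanAEC2009, Prop. III.4.2(a)] -/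
theorem divisible_and_primary_gr (d : (reductionDatum W p hpv hΔ).Gr) :
    (∃ d' : (reductionDatum W p hpv hΔ).Gr, p • d' = d) ∧ ∃ k : ℕ, p ^ k • d = 0 := by
  obtain ⟨m, rfl⟩ := (reductionDatum W p hpv hΔ).grMk_surjective d
  refine ⟨?_, ?_⟩
  · obtain ⟨m', hm'⟩ := GreenbergVatsalTorsionCurve.divisible_curve W p m
    exact ⟨(reductionDatum W p hpv hΔ).grMk m', by rw [← map_nsmul, hm']⟩
  · obtain ⟨k, hk⟩ := (AddCommGroup.mem_primaryComponent).1 m.2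
    refine ⟨k, ?_⟩
    rw [← map_nsmul]
    have : p ^ k • m = 0 := Subtype.ext (by rw [AddSubmonoidClass.coe_nsmul, ZeroMemClass.coe_zero]; exact hk)
    rw [this, map_zero]

/-- **`Frob − 1` is surjective on `D = E[p^∞]/C_v ≅ Ẽ[p^∞]`** (good ordinary `p`): an endomorphism
with finite kernel (`finite_fixed_frob`) of a `p`-divisible `p`-primary group with finite
`p^k`-torsion (`finite_torsionBy_gr`) — `GreenbergVatsalStrictCore.surjective_of_finite_ker_of_divisible`.
Equivalently `H¹(Ẑ·Frob, Ẽ[p^∞]) = 0`. [cite: GreenbergLNM1716, §2 p. 73] -/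
theorem exists_frob_smul_sub_eq (hord : ¬ (p : ℤ) ∣ W.frobeniusTrace p)
    {𝔐 : Ideal v.localAbsIntegers} (h𝔐 : 𝔐 ∈ v.localPrimesAbove)
    {τ : absoluteGaloisGroup (v.adicCompletion ℚ)}
    (hτ : IsArithFrobAt (v.adicCompletionIntegers ℚ) τ 𝔐) (d : (reductionDatum W p hpv hΔ).Gr) :
    ∃ d' : (reductionDatum W p hpv hΔ).Gr,
      (⟨absGaloisRestrict ℚ (v.adicCompletion ℚ) τ, ⟨τ, rfl⟩⟩ : decomp (K := ℚ) v) • d' - d' = d := by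
  set φ₀ : decomp (K := ℚ) v := ⟨absGaloisRestrict ℚ (v.adicCompletion ℚ) τ, ⟨τ, rfl⟩⟩ with hφ₀
  set f : (reductionDatum W p hpv hΔ).Gr →+ (reductionDatum W p hpv hΔ).Gr :=
    DistribSMul.toAddMonoidHom _ φ₀ - AddMonoidHom.id _ with hf
  have hf_apply : ∀ x, f x = φ₀ • x - x := fun x ↦ rfl
  have hsurj := surjective_of_finite_ker_of_divisible (p := p) f
    (fun x ↦ (divisible_and_primary_gr W p hpv hΔ x).2)
    (fun x ↦ (divisible_and_primary_gr W p hpv hΔ x).1)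
    (finite_torsionBy_gr W p hpv hΔ hord)
    (by
      have e : (f.ker : Set (reductionDatum W p hpv hΔ).Gr) = {x | φ₀ • x = x} := by
        ext x
        rw [SetLike.mem_coe, AddMonoidHom.mem_ker, hf_apply, sub_eq_zero, Set.mem_setOf_eq]
      rw [e]
      exact finite_fixed_frob W p hpv hΔ h𝔐 hτ)
  obtain ⟨d', hd'⟩ := hsurj d
  exact ⟨d', by rw [← hf_apply, hd']⟩

end Quotient

end Summit.BirchSwinnertonDyer.Rank1Residual.X2.GreenbergVatsalStrictAtPQuotient

end
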